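import Summits.HodgeConjecture.HodgeConjecture.Theorems.HCCMUnconditionalHDelOfF0   -- ★ p807981 `HDel_holds` (the closer of item stmt-HodgeConjecture-24835)
import Summits.HodgeConjecture.CorCM.DelRec.RecordSystemOfPrinted   -- ★ `CorCM.DelRec.exists_recordSystem_of_printed : canonicalModel_exists_printed → exists_recordSystem`
import HarnessLib

/-!
# Census closers — the two Deligne-record named facts of the `HDel` cone are THEOREMS, by name (director g15 s443 §6 ∕ s480; B-plan2 U396)

After item stmt-HodgeConjecture-24835 (`Theses.HCCMUnconditional.HDel`) closed `proved` by ★ `HCCMUnconditionalHDelOfF0.HDel_holds`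
([MumfordFogartyKirwan1994] Thm. 7.9 + remark ∕ [Lan2013PELCompactifications] Thm. 1.4.1.11 + Cor. 7.2.3.9 from the four ★ cores, then the
★ E-road junction `EquidimRelDimOfF.HDel_of_F_E`), two NAMED FACTS (D-0014 `def … : Prop`, cited, unproved) of
`Literature/AlgebraicGeometry/ShimuraVarieties/` that the route `HCCMUnconditional` still lists as `cite_only` dependencies follow from it
by terms already in the tree.  This file records each of them as a hypothesis-free theorem WHOSE TYPE IS EXACTLY THE REGISTERED FACT, so the
gate's facts probe discharges them by name; nothing new is proved here (both terms were kernel-checked beforehand as `example`s in the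
closure-audit leg `B-provers/B-p14/g21/audit/HDelClosureAxioms.B-p14g21.lean` 41b076758aab143e, director s445):

* `canonicalModel_exists_printed_holds` — `UnitaryCanonicalModel.canonicalModel_exists_printed` ([Deligne1979ShimuraVarieties] 2.2.5 +
  Cor. 2.7.21 as printed, on the datum `(Res_{L⁺/ℚ} U(H), 𝔹²)`): the route decl `HDel` unfolds DEFINITIONALLY to it
  (`Theses.HCCMUnconditional.HDel := …PrintedCitationHypotheses.HypDel := UnitaryCanonicalModel.canonicalModel_exists_printed`,
  `CorCM/D2Bridge/PrintedCitationHypothesesT.lean`), so the term is ★ `HDel_holds` itself;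
* `exists_recordSystem_holds` — `UnitaryCanonicalModel.exists_recordSystem` (the packaged 7-field Deligne record displayed as the binder
  `h` of the END files): ★ `CorCM.DelRec.exists_recordSystem_of_printed` ([Del79] 2.1.2–2.1.4 proved on the tree's ball quotients +
  the printed existential + `RecordSystem.nonempty_of_descent`) applied to the first theorem.

Books effect (director s480, stated in advance): digits unchanged; the currency is the gate's named-fact debt — after this file the route's
`cite_only` list is expected to shrink from {`lan2013_siegelFineModuliScheme`, `canonicalModel_exists_printed`, `exists_recordSystem`} to
{`lan2013_siegelFineModuliScheme`} (a genuine printed citation of the 7, rung-0 debt).  HC_CM is proved only modulo the 7 printed citations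
until rung 0 closes; this file changes no binder of the headline and says nothing about Hodge classes.

## References (copied from the fact definitions)
* [Deligne1979ShimuraVarieties] P. Deligne, *Variétés de Shimura: interprétation modulaire, et techniques de construction de modèles
  canoniques*, 2.1.2–2.1.4, 2.2.5, Thm. 2.7.20 (a), Cor. 2.7.21 (PDF pp. 24, 29, 51–52 of Milne's translation).
* [Milne2005ShimuraVarieties] J. S. Milne, *Introduction to Shimura varieties*, Def. 12.8 (62) p. 114; Def. 12.10 p. 115; Thm. 14.15 –
  Rem. 14.17 pp. 127–128.
* [Liu2021] Y. Liu, App. C §C.1 l. 4597–4599 and Rem. C.2.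
* [MumfordFogartyKirwan1994] D. Mumford, J. Fogarty, F. Kirwan, *Geometric Invariant Theory*, Thm. 7.9–7.10 p. 139 and the remark after 7.9.
* [Lan2013PELCompactifications] K.-W. Lan, *Arithmetic compactifications of PEL-type Shimura varieties*, Thm. 1.4.1.11 p. 91, Cor. 7.2.3.9 p. 518.
-/

-- The summit and its single sub-problem are both named `HodgeConjecture` (D-0017 nested layout).
set_option linter.dupNamespace false

namespace Summit.HodgeConjecture.HodgeConjecture.Theorems.HCCMUnconditionalCensusClosers

/-- **[Deligne1979ShimuraVarieties, 2.2.5 + Cor. 2.7.21] AS PRINTED IS A THEOREM of the tree**: the named fact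
`UnitaryCanonicalModel.canonicalModel_exists_printed` — at every datum (`L` CM, `H ∈ M₃(L)` with a frame of signature `(2,1)` at `τ`,
positive definite off the place of `τ`, anisotropic; `K₀` with torsion-free conjugate arithmetic levels) EVERY complex record system `Sc`
admits an `L`-descent `(M, e : M ⊗_{L,τ} ℂ ≅ Sc.Mc)` by smooth projective `L`-schemes with the reciprocity (62) at the diagonal special
points.  Term: ★ `HCCMUnconditionalHDelOfF0.HDel_holds` — the route decl `Theses.HCCMUnconditional.HDel` is by definition
`PrintedCitationHypotheses.HypDel`, itself by definition this fact, so the closer of item stmt-HodgeConjecture-24835 IS a proof of it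
(definitional unfolding only; closure-audit leg (3), director s445).  HC_CM is proved only modulo the 7 printed citations until rung 0
closes; this theorem discharges the `cite_only` dependency `canonicalModel_exists_printed` by name and asserts nothing else.
[cite: Deligne1979ShimuraVarieties, 2.2.5 and Cor. 2.7.21 (PDF pp. 29, 52 of Milne's translation); 2.1.2–2.1.4]
[cite: Milne2005ShimuraVarieties, Def. 12.8 (62) p. 114; Def. 12.10 p. 115; Thm. 14.15–Rem. 14.17 pp. 127–128]
[cite: MumfordFogartyKirwan1994, Thm. 7.9 with the remark following it (p. 139)] [cite: Lan2013PELCompactifications, Thm. 1.4.1.11 (p. 91) and Cor. 7.2.3.9 (p. 518)] -/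
theorem canonicalModel_exists_printed_holds :
    Literature.AlgebraicGeometry.ShimuraVarieties.UnitaryCanonicalModel.canonicalModel_exists_printed :=
  Summit.HodgeConjecture.HodgeConjecture.Theorems.HCCMUnconditionalHDelOfF0.HDel_holds

/-- **The packaged Deligne record `exists_recordSystem` IS A THEOREM of the tree** ([Deligne1979ShimuraVarieties] 2.2.5 + Cor. 2.7.21 with
2.1.2–2.1.4 and [Milne2005ShimuraVarieties] Def. 12.8 (62), read on the one datum `(Res_{L⁺/ℚ} U(H), 𝔹²)` and packaged as the 7-field
`RecordSystem L H τ T hT K₀` — the binder `h` displayed by the END files): at every datum as above, `Nonempty (RecordSystem L H τ T hT K₀)`.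
Term: ★ `CorCM.DelRec.exists_recordSystem_of_printed` (`CorCM/DelRec/RecordSystemOfPrinted.lean`: the complex record system exists with no
named fact by `HComp.nonempty_complexRecordSystem`, the printed existential descends it to `L` with (62), and
`RecordSystem.nonempty_of_descent` assembles the record) applied to `canonicalModel_exists_printed_holds` (closure-audit leg (4), director
s445).  HC_CM is proved only modulo the 7 printed citations until rung 0 closes; this theorem discharges the `cite_only` dependency
`exists_recordSystem` by name and asserts nothing else.
[cite: Deligne1979ShimuraVarieties, 2.2.5 and Cor. 2.7.21; 2.1.2–2.1.4]
[cite: Milne2005ShimuraVarieties, Def. 12.8 (62) p. 114; Def. 12.10 p. 115; Thm. 14.15–Rem. 14.17 pp. 127–128] -/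
theorem exists_recordSystem_holds :
    Literature.AlgebraicGeometry.ShimuraVarieties.UnitaryCanonicalModel.exists_recordSystem :=
  Summit.HodgeConjecture.CorCM.DelRec.exists_recordSystem_of_printed canonicalModel_exists_printed_holds

end Summit.HodgeConjecture.HodgeConjecture.Theorems.HCCMUnconditionalCensusClosers
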